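import Summits.Ventures.HodgeRepro2.T5SU11LegendreWronskian
import Summits.Ventures.HodgeRepro2.T5SU11SphericalLegendreHigher

/-!
# The second solution of the radial equation of `SU(1,1)` at `λ = 2n + 2`: `t ↦ Q_n(cosh 2t)`

The spherical function `φ_{2n+2}(a_t) = P_n(cosh 2t)` (row 384) solves the radial equation
`sinh 2t · u″ + 2 cosh 2t · u′ = λ(λ − 2) sinh 2t · u`, `λ = 2n + 2` (row 342's `sph_hyp_ode`). The Legendre function
of the second kind gives the SECOND SOLUTION: with `v(t) := Q_n(cosh 2t)` (`sphQ`), the chain rule and the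
Legendre equation of row 435 give **`sinh 2t · v″ + 2 cosh 2t · v′ = (2n + 2)(2n) sinh 2t · v` for every `t ≠ 0`**
(`sphQ_ode`). Moreover `v > 0` and `v′ < 0` on `t > 0` (`sphQ_pos`, `sphQ'_neg`), `v` is strictly decreasing
there (`strictAntiOn_sphQ`), `v(t) → 0` as `t → ∞` with the exact rate **`e^{(2n+2)t} v(t) → 2ⁿ⁺¹/((2n + 1) lc_n)`**
(`tendsto_exp_mul_sphQ`: `v` decays like `e^{−(2n+2)t}` while `φ_{2n+2}` grows like `e^{2nt}`), and the
Wronskian of the two solutions is **`φ_{2n+2}(a_t) v′(t) − (d/dt φ_{2n+2}(a_t)) v(t) = −2/sinh 2t`**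
(`wronskian_sphQ`, from row 439). Nothing is claimed about (N).

Blind lane: Mathlib + the HodgeRepro2 prefix only; no sorry; axioms ⊆ {propext, Classical.choice,
Quot.sound}.
-/

namespace Summit.Ventures.HodgeRepro2.T5SU11SphericalSecondKind

open Filter Topology
open Set (Ioi)
open T5SU11SphericalLegendreAll T5SU11SphericalLegendreHigher T5SU11LegendreIdentities T5SU11JacobiLegendreLeading
  T5SU11LegendreSecondKind T5SU11LegendreSecondKindODE T5SU11LegendreSecondKindSeries T5SU11LegendreWronskian
  T5SU11Cartan T5SU11SphericalFunction

/-! ### The second solution -/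

/-- **`v(t) = Q_n(cosh 2t)`**, the second solution of the radial equation at `λ = 2n + 2`. -/
noncomputable def sphQ (n : ℕ) (t : ℝ) : ℝ := legQ2 n (Real.cosh (2 * t))

/-- `v′(t) = 2 sinh 2t · Q′_n(cosh 2t)`. -/
noncomputable def sphQ' (n : ℕ) (t : ℝ) : ℝ := 2 * Real.sinh (2 * t) * legQ2' n (Real.cosh (2 * t))

/-- `v″(t) = 4 cosh 2t · Q′_n(cosh 2t) + 4 sinh² 2t · Q″_n(cosh 2t)`. -/
noncomputable def sphQ'' (n : ℕ) (t : ℝ) : ℝ :=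
  4 * Real.cosh (2 * t) * legQ2' n (Real.cosh (2 * t)) + 4 * Real.sinh (2 * t) ^ 2 * legQ2'' n (Real.cosh (2 * t))

/-- `cosh 2t > 1` for `t ≠ 0`. -/
theorem one_lt_cosh_two_mul {t : ℝ} (ht : t ≠ 0) : 1 < Real.cosh (2 * t) := by
  rw [Real.one_lt_cosh]
  exact mul_ne_zero two_ne_zero ht

/-- `v` has derivative `v′` at every `t ≠ 0`. -/
theorem hasDerivAt_sphQ (n : ℕ) {t : ℝ} (ht : t ≠ 0) : HasDerivAt (sphQ n) (sphQ' n t) t := by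
  have h := (hasDerivAt_legQ2 n (one_lt_cosh_two_mul ht)).comp t (hasDerivAt_cosh_two_mul_self t)
  refine h.congr_deriv ?_
  simp only [sphQ']
  ring

/-- `v′` has derivative `v″` at every `t ≠ 0`. -/
theorem hasDerivAt_sphQ' (n : ℕ) {t : ℝ} (ht : t ≠ 0) : HasDerivAt (sphQ' n) (sphQ'' n t) t := by
  have h := ((hasDerivAt_sinh_two_mul_self t).const_mul 2).mul
    ((hasDerivAt_legQ2' n (one_lt_cosh_two_mul ht)).comp t (hasDerivAt_cosh_two_mul_self t))
  refine h.congr_deriv ?_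
  simp only [sphQ'', Function.comp_apply]
  ring

/-- **THE SECOND SOLUTION OF THE RADIAL EQUATION**: `sinh 2t · v″ + 2 cosh 2t · v′ = (2n + 2)(2n) sinh 2t · v` for
every `t ≠ 0` (the form of row 342's `sph_hyp_ode` with `λ = 2n + 2`). -/
theorem sphQ_ode (n : ℕ) {t : ℝ} (ht : t ≠ 0) :
    Real.sinh (2 * t) * sphQ'' n t + 2 * Real.cosh (2 * t) * sphQ' n t
      = (2 * (n : ℝ) + 2) * ((2 * (n : ℝ) + 2) - 2) * Real.sinh (2 * t) * sphQ n t := by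
  have hode := legendre_ode_legQ2 n (one_lt_cosh_two_mul ht)
  have hcs : Real.sinh (2 * t) ^ 2 = Real.cosh (2 * t) ^ 2 - 1 := by
    have := Real.cosh_sq (2 * t)
    linarith
  simp only [sphQ, sphQ', sphQ'']
  rw [hcs]
  linear_combination (-4 * Real.sinh (2 * t)) * hode

/-- The classical form for `t ≠ 0`: `v″ + 2 coth 2t · v′ = (2n + 2)(2n) v`. -/
theorem sphQ_ode_div (n : ℕ) {t : ℝ} (ht : t ≠ 0) :
    sphQ'' n t + 2 * (Real.cosh (2 * t) / Real.sinh (2 * t)) * sphQ' n t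
      = (2 * (n : ℝ) + 2) * ((2 * (n : ℝ) + 2) - 2) * sphQ n t := by
  have hS : Real.sinh (2 * t) ≠ 0 := by
    rw [Ne, Real.sinh_eq_zero]
    exact mul_ne_zero two_ne_zero ht
  have h := sphQ_ode n ht
  field_simp
  linear_combination h

/-! ### Positivity, monotonicity, decay -/

/-- `v(t) > 0` for `t ≠ 0` (row 438). -/
theorem sphQ_pos (n : ℕ) {t : ℝ} (ht : t ≠ 0) : 0 < sphQ n t := legQ2_pos n (one_lt_cosh_two_mul ht)

/-- `v′(t) < 0` for `t > 0` (row 439). -/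
theorem sphQ'_neg (n : ℕ) {t : ℝ} (ht : 0 < t) : sphQ' n t < 0 := by
  have h1 : 0 < Real.sinh (2 * t) := Real.sinh_pos_iff.mpr (by linarith)
  have h2 := legQ2'_neg n (one_lt_cosh_two_mul ht.ne')
  simp only [sphQ']
  nlinarith

/-- **`v` is strictly decreasing on `(0, ∞)`.** -/
theorem strictAntiOn_sphQ (n : ℕ) : StrictAntiOn (sphQ n) (Ioi 0) := by
  intro s hs t ht hst
  have hs' : 1 < Real.cosh (2 * s) := one_lt_cosh_two_mul hs.out.ne'
  have hlt : Real.cosh (2 * s) < Real.cosh (2 * t) := by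
    rw [Real.cosh_lt_cosh, abs_of_pos (by linarith [hs.out]), abs_of_pos (by linarith [ht.out])]
    linarith
  exact strictAntiOn_legQ2 n hs' (lt_trans hs' hlt) hlt

/-- `v(t) ≤ 1/(cosh 2t − 1)` for `t ≠ 0` (row 434). -/
theorem sphQ_le (n : ℕ) {t : ℝ} (ht : t ≠ 0) : sphQ n t ≤ 1 / (Real.cosh (2 * t) - 1) :=
  (le_abs_self _).trans (abs_legQ2_le n (one_lt_cosh_two_mul ht))

/-- `cosh 2t → ∞` as `t → ∞`. -/
theorem tendsto_cosh_two_mul_atTop : Tendsto (fun t : ℝ => Real.cosh (2 * t)) atTop atTop := by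
  refine tendsto_atTop_mono (fun t => ?_)
    ((Real.tendsto_exp_atTop.comp (tendsto_id.const_mul_atTop (by norm_num : (0 : ℝ) < 2))).atTop_div_const
      (by norm_num : (0 : ℝ) < 2))
  simp only [Function.comp, id]
  rw [Real.cosh_eq]
  have := (Real.exp_pos (-(2 * t))).le
  linarith

/-- `v(t) → 0` as `t → ∞`. -/
theorem tendsto_sphQ_atTop (n : ℕ) : Tendsto (sphQ n) atTop (𝓝 0) :=
  (tendsto_legQ2_atTop n).comp tendsto_cosh_two_mul_atTop

/-- `e^{2t}/cosh 2t → 2` as `t → ∞`. -/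
theorem tendsto_exp_div_cosh : Tendsto (fun t : ℝ => Real.exp (2 * t) / Real.cosh (2 * t)) atTop (𝓝 2) := by
  have e : ∀ t : ℝ, Real.exp (2 * t) / Real.cosh (2 * t) = 2 / (1 + Real.exp (-(2 * t)) / Real.exp (2 * t)) := by
    intro t
    rw [Real.cosh_eq]
    have h1 : Real.exp (2 * t) ≠ 0 := (Real.exp_pos _).ne'
    field_simp
  simp_rw [e]
  have h : Tendsto (fun t : ℝ => Real.exp (-(2 * t)) / Real.exp (2 * t)) atTop (𝓝 0) := by
    have e2 : ∀ t : ℝ, Real.exp (-(2 * t)) / Real.exp (2 * t) = Real.exp (-(4 * t)) := fun t => by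
      rw [← Real.exp_sub]
      ring_nf
    simp_rw [e2]
    have hlin : Tendsto (fun t : ℝ => -(4 * t)) atTop atBot :=
      tendsto_neg_atTop_atBot.comp (tendsto_id.const_mul_atTop (by norm_num : (0 : ℝ) < 4))
    exact Real.tendsto_exp_atBot.comp hlin
  have := (tendsto_const_nhds (x := (2 : ℝ))).div ((tendsto_const_nhds (x := (1 : ℝ))).add h) (by norm_num)
  rw [add_zero, div_one] at this
  exact this.congr fun t => rfl

/-- **THE EXACT DECAY**: `e^{(2n+2)t} v(t) → 2ⁿ⁺¹/((2n + 1) lc_n)` as `t → ∞` (row 438's asymptotic): the second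
solution decays like `e^{−(2n+2)t}` while `φ_{2n+2}(a_t)` grows like `e^{2nt}`. -/
theorem tendsto_exp_mul_sphQ (n : ℕ) :
    Tendsto (fun t => Real.exp ((2 * (n : ℝ) + 2) * t) * sphQ n t) atTop
      (𝓝 (2 ^ (n + 1) / ((2 * (n : ℝ) + 1) * legLead n))) := by
  have h1 := (tendsto_pow_mul_legQ2 n).comp tendsto_cosh_two_mul_atTop
  have h2 := (tendsto_exp_div_cosh).pow (n + 1)
  have e : ∀ t : ℝ, Real.exp ((2 * (n : ℝ) + 2) * t) * sphQ n t
      = (Real.exp (2 * t) / Real.cosh (2 * t)) ^ (n + 1) * (Real.cosh (2 * t) ^ (n + 1) * legQ2 n (Real.cosh (2 * t))) := by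
    intro t
    have hc0 : Real.cosh (2 * t) ≠ 0 := (Real.cosh_pos _).ne'
    have hexp : (2 * (n : ℝ) + 2) * t = ((n + 1 : ℕ) : ℝ) * (2 * t) := by
      push_cast
      ring
    simp only [sphQ]
    rw [hexp, Real.exp_nat_mul, div_pow]
    field_simp
  simp_rw [e]
  have := h2.mul h1
  simp only [Function.comp_def] at this
  convert this using 2
  rw [div_eq_mul_one_div]

/-! ### The Wronskian on the group -/

section measure

variable [MeasurableSpace Circle] [BorelSpace Circle]

/-- **The Wronskian of `φ_{2n+2}(a_t)` and `v(t)`**: `φ_{2n+2}(a_t) v′(t) − (d/dt φ_{2n+2}(a_t)) v(t) = −2/sinh 2t`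
for `t ≠ 0` (row 439's `P_n Q′_n − P′_n Q_n = 1/(1 − x²)` at `x = cosh 2t`). -/
theorem wronskian_sphQ (n : ℕ) {t : ℝ} (ht : t ≠ 0) :
    sph (2 * (n : ℝ) + 2) (hyp t) * sphQ' n t
      - (2 * Real.sinh (2 * t) * legQ n (Real.cosh (2 * t))) * sphQ n t = -2 / Real.sinh (2 * t) := by
  have hS : Real.sinh (2 * t) ≠ 0 := by
    rw [Ne, Real.sinh_eq_zero]
    exact mul_ne_zero two_ne_zero ht
  have hW := legP_mul_legQ2'_sub_legQ_mul_legQ2 n (one_lt_cosh_two_mul ht)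
  have hcs : 1 - Real.cosh (2 * t) ^ 2 = -Real.sinh (2 * t) ^ 2 := by
    have := Real.cosh_sq (2 * t)
    linarith
  rw [sph_even_hyp]
  simp only [sphQ, sphQ']
  rw [hcs] at hW
  have h1 : Real.sinh (2 * t) ^ 2 ≠ 0 := pow_ne_zero 2 hS
  have e : legP n (Real.cosh (2 * t)) * legQ2' n (Real.cosh (2 * t))
      - legQ n (Real.cosh (2 * t)) * legQ2 n (Real.cosh (2 * t)) = -(1 / Real.sinh (2 * t) ^ 2) := by
    rw [hW]
    field_simp
  have e2 : Real.sinh (2 * t) * (legP n (Real.cosh (2 * t)) * legQ2' n (Real.cosh (2 * t))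
      - legQ n (Real.cosh (2 * t)) * legQ2 n (Real.cosh (2 * t))) = -(1 / Real.sinh (2 * t)) := by
    rw [e]
    field_simp
  calc legP n (Real.cosh (2 * t)) * (2 * Real.sinh (2 * t) * legQ2' n (Real.cosh (2 * t)))
        - 2 * Real.sinh (2 * t) * legQ n (Real.cosh (2 * t)) * legQ2 n (Real.cosh (2 * t))
      = 2 * (Real.sinh (2 * t) * (legP n (Real.cosh (2 * t)) * legQ2' n (Real.cosh (2 * t))
          - legQ n (Real.cosh (2 * t)) * legQ2 n (Real.cosh (2 * t)))) := by ring
    _ = -2 / Real.sinh (2 * t) := by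
        rw [e2]
        ring

/-- The derivative of `φ_{2n+2}(a_t)` is `2 sinh 2t · P′_n(cosh 2t)`. -/
theorem hasDerivAt_sph_even_hyp (n : ℕ) (t : ℝ) :
    HasDerivAt (fun t => sph (2 * (n : ℝ) + 2) (hyp t)) (2 * Real.sinh (2 * t) * legQ n (Real.cosh (2 * t))) t := by
  have e : (fun t => sph (2 * (n : ℝ) + 2) (hyp t)) = fun t => legP n (Real.cosh (2 * t)) :=
    funext fun t => sph_even_hyp n t
  rw [e]
  have h := (hasDerivAt_legP n (Real.cosh (2 * t))).comp t (hasDerivAt_cosh_two_mul_self t)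
  refine h.congr_deriv ?_
  ring

end measure

end Summit.Ventures.HodgeRepro2.T5SU11SphericalSecondKind
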